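import Summits.ABC.StewartYu.PadicTwoThirdLog
import Summits.ABC.StewartYu.DescentIntegralityThirdQ
import HarnessLib

/-!
# Cell abc-stewartyu, W80Two (xi): record-free JUNCTIONS between per-unknown size bounds and the
# `Prop`s of the `2`-adic machine

`Summits/ABC/StewartYu/PadicTwoJunctions.lean` — cell `abc-stewartyu` (seat p2; crux `W80Two`
stmt-ABC-19486), sequel to `PadicTwoThirdLog.lean` and `DescentIntegralityThirdQ.lean`.  Theorems only;
no named fact; NO parameter record (twin of p3's `PadicCW77Junctions.lean`).  The pack (`PadicTwoPack`)
plugs the record's PER-UNKNOWN closed forms into these, one call per field of `ParamPack3`: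

* `abs_coreSum3_le_of_bounds` — `|coreSum3_{J,τ}(s)| ≤ #box3_J · Pr · Q` from `|p(u)| ≤ Pr` and
  `|qTerm3(u)| ≤ Q` on the box;
* **`kSizes3_of_bounds`** — `KSizes3` from the invariant (`|p(u)| ≤ P ≤ Pr`), the denominator bound
  `Dclear3_J(s₁,τ) ≤ Dmax k`, the per-unknown bound `|qTerm3_{J}(u,τ,s₁)| ≤ Qmax k` and
  `#box3_J · Pr · Qmax k ≤ Mmax k` (denominators := `Dclear3_J`, integrality by
  `exists_int_Dclear3_mul_coreSum3`);
* **`thirdMb_of_bound`** — the `ℓ¹`-majorant of the third-point weights: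
  `∑_u P·|qΔ3_{J+1} qA♭ qEt| ≤ #box3_J · P · R` from `|qΔ3_{J+1} qA♭ qEt| ≤ R` on the box;
* `ceil_card_mul_le` — `⌈#box3₀ · A⌉ ≤ B·A + 1 … ≤` the record's `PrV` (the integer bound of Siegel's step).

[folklore] bookkeeping.
-/

noncomputable section

open NormedSpace Finset IsUltrametricDist
open Literature.NumberTheory.Transcendental
open Literature.NumberTheory.Transcendental.CW77.Setup (Idx Tau tauNorm)
open scoped Nat

namespace Summit.ABC.StewartYu

namespace TwoSetup

variable (S : TwoSetup) {h Lb : ℕ}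

/-! ### The size of the rational core from per-unknown bounds -/

/-- **`|coreSum3_{J,τ}(s)| ≤ #box · Pr · Q`** if `|p(u)| ≤ Pr` and `|qTerm3(u,τ,s)| ≤ Q` on the box
(`Pr ≥ 0`). [folklore] -/
theorem abs_coreSum3_le_of_bounds (J₀ J : ℕ) (box : Finset (Idx S.d h Lb)) (pv : Idx S.d h Lb → ℤ)
    (τ : Tau S.d) (s : ℕ) {Pr Q : ℝ} (hPr : 0 ≤ Pr) (hp : ∀ u ∈ box, |(pv u : ℝ)| ≤ Pr)
    (hq : ∀ u ∈ box, |(S.toQ.qTerm3 J₀ J u τ s : ℝ)| ≤ Q) :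
    |(S.toQ.coreSum3 J₀ J box pv τ s : ℝ)| ≤ box.card * Pr * Q := by
  unfold SetupQ.coreSum3
  push_cast
  calc |∑ u ∈ box, (pv u : ℝ) * (S.toQ.qTerm3 J₀ J u τ s : ℝ)|
      ≤ ∑ u ∈ box, |(pv u : ℝ) * (S.toQ.qTerm3 J₀ J u τ s : ℝ)| := abs_sum_le_sum_abs _ _
    _ ≤ ∑ _u ∈ box, Pr * Q := sum_le_sum fun u hu => by
        rw [abs_mul]; exact mul_le_mul (hp u hu) (hq u hu) (abs_nonneg _) hPr
    _ = box.card * Pr * Q := by rw [sum_const, nsmul_eq_mul]; ring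

/-- **`KSizes3` from per-unknown bounds**: from the invariant `Inv3` at level `J` (giving `|p(u)| ≤ P`),
`P ≤ Pr`, and for every `k < d`, `|τ| + t ≤ T/3ᴶ − k t`, `s₁ < 3^{k+1+J} S₀`, `3 ∤ s₁`: the denominator
bound `Dclear3_J(s₁,τ) ≤ Dmax k`, the per-unknown bound `|qTerm3_J(u,τ,s₁)| ≤ Qmax k` on the box of
level `J`, and `#box3_J · Pr · Qmax k ≤ Mmax k`. [folklore] -/
theorem kSizes3_of_bounds {J₀ J : ℕ} {L : Fin S.d → ℕ} {Lθ S₀ T t : ℕ} {P : ℤ}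
    {pv : Idx S.d h Lb → ℤ} (inv : S.toQ.Inv3 J₀ L Lθ S₀ T P J pv) {Pr : ℝ} (hPr : (P : ℝ) ≤ Pr)
    {Dmax Qmax Mmax : ℕ → ℝ}
    (hD : ∀ k, k < S.d → ∀ τ : Tau S.d, tauNorm τ + t ≤ T / 3 ^ J - k * t →
      ∀ s₁, s₁ < 3 ^ (k + 1 + J) * S₀ → ¬ 3 ∣ s₁ →
        ((S.toQ.Dclear3 (h := h) J L Lθ s₁ τ : ℕ) : ℝ) ≤ Dmax k)
    (hq : ∀ k, k < S.d → ∀ τ : Tau S.d, tauNorm τ + t ≤ T / 3 ^ J - k * t →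
      ∀ s₁, s₁ < 3 ^ (k + 1 + J) * S₀ → ¬ 3 ∣ s₁ →
        ∀ u ∈ S.toQ.box3 (h := h) (Lb := Lb) L Lθ J, |(S.toQ.qTerm3 J₀ J u τ s₁ : ℝ)| ≤ Qmax k)
    (hM : ∀ k, k < S.d →
      ((S.toQ.box3 (h := h) (Lb := Lb) L Lθ J).card : ℝ) * Pr * Qmax k ≤ Mmax k) :
    S.KSizes3 J₀ J L Lθ S₀ T t pv Dmax Mmax := by
  intro k hk τ hτ s₁ hs₁ h3
  have hP0 : (0 : ℝ) ≤ Pr := by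
    obtain ⟨u, hu⟩ := inv.nonzero
    have h1 : (0 : ℝ) ≤ |(pv u : ℝ)| := abs_nonneg _
    have h2 : |(pv u : ℝ)| ≤ (P : ℝ) := by exact_mod_cast inv.bound u
    linarith
  refine ⟨S.toQ.Dclear3 (h := h) J L Lθ s₁ τ, S.toQ.Dclear3_pos J L Lθ s₁ τ, hD k hk τ hτ s₁ hs₁ h3,
    S.toQ.exists_int_Dclear3_mul_coreSum3 J₀ J L Lθ pv τ s₁, ?_⟩
  refine (S.abs_coreSum3_le_of_bounds J₀ J _ pv τ s₁ hP0
    (fun u _ => le_trans (by exact_mod_cast inv.bound u) hPr) (hq k hk τ hτ s₁ hs₁ h3)).trans (hM k hk)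

/-! ### The `ℓ¹`-majorant of the third-point weights -/

/-- **`∑_{u ∈ box} P·|qΔ3_{J₀,J+1}(u;τ₀,s) · qA♭(u,τ') · qEt(u,s)| ≤ #box · P · R`** if every weight is
bounded by `R` on the box (`P ≥ 0`) — the `hMbP` input of `thirdStep_of_log_ineq` with
`Mb(s,τ) := #box3_J · P · R(s,τ)`. [folklore] -/
theorem thirdMb_of_bound (J₀ J : ℕ) (box : Finset (Idx S.d h Lb)) (τ : Tau S.d) (s : ℕ) {P R : ℝ}
    (hP : 0 ≤ P)
    (hR : ∀ u ∈ box, |((S.toQ.qΔ3 J₀ (J + 1) u τ.1 s * S.frame.qA u τ.2 * S.toQ.qEt u s : ℚ) : ℝ)| ≤ R) :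
    ∑ u ∈ box, P * |((S.toQ.qΔ3 J₀ (J + 1) u τ.1 s * S.frame.qA u τ.2 * S.toQ.qEt u s : ℚ) : ℝ)| ≤
      box.card * P * R := by
  calc ∑ u ∈ box, P * |((S.toQ.qΔ3 J₀ (J + 1) u τ.1 s * S.frame.qA u τ.2 * S.toQ.qEt u s : ℚ) : ℝ)|
      ≤ ∑ _u ∈ box, P * R := sum_le_sum fun u hu => mul_le_mul_of_nonneg_left (hR u hu) hP
    _ = box.card * P * R := by rw [sum_const, nsmul_eq_mul]; ring

/-- `#box · P · R ≥ 1` as soon as the box is nonempty, `P ≥ 1`, `R ≥ 1` (the `hMb` input). [folklore] -/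
theorem one_le_card_mul_mul {box : Finset (Idx S.d h Lb)} (hne : box.Nonempty) {P R : ℝ} (hP : 1 ≤ P)
    (hR : 1 ≤ R) : (1 : ℝ) ≤ box.card * P * R := by
  have hc : (1 : ℝ) ≤ box.card := by exact_mod_cast Finset.card_pos.mpr hne
  exact one_le_mul_of_one_le_of_one_le (one_le_mul_of_one_le_of_one_le hc hP) hR

/-- The box of level `J` is nonempty when `0 < h` and `0 < Lb` (it contains `(0, 0; 0, 0)`). [folklore] -/
theorem box3_nonempty (hh : 0 < h) (hLb : 0 < Lb) (L : Fin S.d → ℕ) (Lθ J : ℕ) :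
    (S.toQ.box3 (h := h) (Lb := Lb) L Lθ J).Nonempty := by
  refine ⟨((⟨0, hh⟩, ⟨0, hLb⟩), (fun _ => 0, 0)), ?_⟩
  rw [S.toQ.mem_box3]
  exact ⟨fun _ => Nat.zero_le _, Nat.zero_le _⟩

/-! ### The integer bound of Siegel's step -/

/-- **`⌈B · A⌉ ≤ B' · A`** whenever `B + 1 ≤ B'` and `A ≥ 1` (so the Siegel bound
`⌈#box3₀ · Amax⌉` is at most the record's `PrV = (𝔔+1)·Amax`-type closed form). [folklore] -/
theorem ceil_mul_le {B B' A : ℝ} (hBB' : B + 1 ≤ B') (hA : 1 ≤ A) :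
    ((⌈B * A⌉ : ℤ) : ℝ) ≤ B' * A := by
  have h1 := Int.ceil_lt_add_one (B * A)
  have h2 : B * A + 1 ≤ B' * A := by nlinarith
  linarith [h1.le]

/-- The integer bound is at least `1` when the box is nonempty and `A ≥ 1`. [folklore] -/
theorem one_le_ceil_card_mul {box : Finset (Idx S.d h Lb)} (hne : box.Nonempty) {A : ℝ} (hA : 1 ≤ A) :
    (1 : ℤ) ≤ ⌈(box.card : ℝ) * A⌉ := by
  have hc : (1 : ℝ) ≤ box.card := by exact_mod_cast Finset.card_pos.mpr hne
  have h1 : (1 : ℝ) ≤ (box.card : ℝ) * A := one_le_mul_of_one_le_of_one_le hc hA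
  exact Int.le_ceil_iff.mpr (by push_cast; linarith)

end TwoSetup

end Summit.ABC.StewartYu

end
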